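import Mathlib
import Literature.MathematicalPhysics.QuantumFieldTheory.Balaban1983to89.TreeLengthTorusGeometry

/-!
# `Balaban1983to89.TreeLengthTorusTransfer` — the coarsening / scale-transfer leaves behind [Balaban1988RG2Cluster]
(2.36) PROVED ON THE TORUS under L ∣ N: [Dimock2013] Lemma 20 (adjoining) and Lemma 10 (exact coarsening) for
`torusTreeLen`, X̃ and Z ↦ Z′ on the periodic carrier, and the kernel substitute L·d_{k+1}(Z′) ≤ A·d_k(Z) + B between
the two torus catalogues 𝐃_k (L·N′ cubes per direction) and 𝐃_{k+1} (N′ blocks per direction)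

CITATION HEADER (lean-in-tree rule 2026-08-18).  Sources under audit: T. Bałaban, *Renormalization group approach to
lattice gauge field theories. I*, Commun. Math. Phys. **109**, 249–301 (1987) [Balaban1987RG1] (cell paper B12;
p. 251 = PDF p. 3, p. 257 = PDF p. 9); *II. Cluster expansions*, Commun. Math. Phys. **116**, 1–22 (1988)
[Balaban1988RG2Cluster] (cell paper B13; p. 13 = PDF p. 13, (2.36) p. 19 = PDF p. 19, p. 20).  PUBLISHED, PROVED inputs
whose mechanisms are re-proved here for the torus objects: J. Dimock, *The renormalization group according to Balaban,
I. Small fields*, Rev. Math. Phys. **25** (2013) 1330010, arXiv:1108.1335 [Dimock2013], §3 proof of Lemma 10 (first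
sentence) and §4 Lemma 20 (held text `paper:arxiv-1108.1335`, pp. 12 and 20 of the arXiv version, re-read this
session).  The sentences quoted below were re-read this session on the renders `1988-cmp116-rg-II-cluster-p013-x2.png`,
`…-p019-x2.png`, `1987-cmp109-rg-I-small-field-p009-x2.png` (read as images) and are ALSO quoted verbatim — and were
cross-read (cell GAPS.md C-pv22-2, C-pv23-4, C-pv27-2, C-pv18-11) — in the docstrings of the imported modules
`…Balaban1983to89.B13ScaleTransfer` (unit pv11: `block` = □̃, `collar` = X̃, `coarse`, `closureIdx` = Z ↦ Z′,
`CoarseningLeaf`, `AdjoinLeaf`, `ScaleTransfer`, `Acoef`, `Bcoef`, `exp_transfer`), `…Balaban1983to89.TreeLength` (unit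
pv22: `cube`, `carrier`, `len`, `Admissible`, `treeLen`, `exists_wall_point`, `adjoin_step`, `scaleSeg`,
`smul_mem_cube_coarse`, `admissible_scale`, `mul_treeLen_closureIdx_le`, `treeLen_le_card_sdiff_add`,
`scaleTransfer_treeLen_sharp` — the WINDOW / ℤ^d versions of everything below), `…Balaban1983to89.TreeLengthTorus`
(unit pv22 gen 2: the periodic index model `TPt d N = (ℤ/N)^d`, `proj`, `natLift`, `TAdj`, `exists_lift_adj`, `TLinked`,
`TFaceConnected`, `exists_tfrontier`, `liftCubes`, `TAdmissible`, `torusTreeLen`, `exists_tAdmissible`,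
`card_le_torusTreeLen`, `TDom`, `tsys`) and `…Balaban1983to89.TreeLengthTorusGeometry` (unit pv22 gen 2: the deck
transformations `period`, `proj_add_period`, `exists_period_of_proj_eq`, `liftCubes_mono`, `cube_subset_liftCubes`,
`finset_nonempty_of_tAdmissible`, `exists_tAdmissible_len_lt`).  Cell records: DIVERGENCE D-pv22.3 (window versus
torus; after `…TreeLengthTorusGeometry` its residual read *"the coarsening / scale-transfer leaves … are NOT redone on
the torus (a scale transfer by L on the torus needs L ∣ N)"* — THIS module redoes them), D-pv22g2.1 (the covering-space
reading of d_j on the torus), D-pv22.1 (conventions of the tree length), D-b13.9 (transfer factor); GAPS.md G-B13-09 /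
G-B13-09R / C-B13-09 ((2.36) unproved in print; certified substitutes), C-pv11-1, C-pv22-2, C-pv22g2-1/2; unit
`b2b-balaban-pv22` gen 3 (surge node prover #22), journal claim TORUS-TRANSFER-KERNEL.  Imports
`…TreeLengthTorusGeometry` only; nothing existing is modified.

WHAT THE PAPER PRINTS.  [Balaban1988RG2Cluster] p. 19, verbatim: *"we denote by Z′_i the smallest localization domain
from 𝐃_{k+1} containing Z̃_i"* and *"The remaining exponential is bounded using the following inequality:
2d_k(Z_i) ≧ Ld_{k+1}(Z′_i). (2.36) This inequality can be obtained by simple, but awkward, geometric and combinatoric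
considerations. It follows by considering locally many possible cases."*; p. 13, verbatim: *"we take cubes from π_{k+1},
i.e. cubes of the size LM in the scale corresponding to the lattice T_η"* and *"Z′₀ is a union of the smallest family
of such cubes containing Z̃₀"*.  [Balaban1987RG1] p. 257, verbatim: *"For a cube □ ∈ π_j and n = 1, 2, … we define □̃ⁿ
as a cube of the size (1 + 2n)M and with a center at the center of □."*, *"The meaning of the symbol X̃ⁿ should be
obvious."*, *"two consecutive cubes have a common wall"*, *"Consider a class of tree graphs contained in X and
intersecting all the cubes in X. A length of a shortest graph in this class, divided by M, is the linear size of X, and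
is denoted by d_j(X)."*, *"Domains from different classes, i.e. classes corresponding to different indices j, are
connected by scaling transformations."* — on the carrier of p. 251, verbatim: *"a torus T obtained by the usual
identification of boundary points of the cube"*.  [Dimock2013] (published exposition, d = 3, carrier a torus — §3,
verbatim: *"Here the tree is in the continuum torus"*), §3 proof of Lemma 10, verbatim: *"If X̄ = Y then a minimal tree
on the M blocks in X is also a tree on the LM blocks in Y and so M d_M(X) ≥ LM d_{LM}(Y)"*; §4 Lemma 20, verbatim:
*"For X, Y ∈ 𝒟_k and X ⊂ Y: M d_M(Y) ≤ M|Y − X|_M + M d_M(X)"*.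

WHAT IS PROVED HERE (kernel-checked, zero `sorry`; every input is a theorem of the imported cell modules or of Mathlib;
all graphs live in the universal cover ℝ^d, READING D-pv22g2.1).  Part 1 — ADJOINING ON THE TORUS: the one-cube adjoin
step across a torus wall, wrap-around walls included (`tadjoin_step`, cost ≤ 1), the greedy extension along torus
frontier cubes (`exists_tAdmissible_extend`, `exists_tAdmissible_of_subset`) and **[Dimock2013] Lemma 20 for
`torusTreeLen`**: d(Ȳ) ≤ |Ȳ ∖ X̄| + d(X̄) for torus localization domains X̄ ⊆ Ȳ (`torusTreeLen_le_card_sdiff_add`).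
Part 2 — TWO NESTED TORI, L ∣ N: for N = L·N′ the block map π_k → π_{k+1} of the SAME torus, ā ↦ ⌊a/L⌋ mod N′
(`tcoarse L N′ : TPt d (L·N′) → TPt d N′`), well defined because ⌊·/L⌋ intertwines the deck groups
(`coarse_add_period`, `tcoarse_proj`: tcoarse ∘ proj_{L·N′} = proj_{N′} ∘ coarse L); it maps torus walls to equal or
wall-adjacent blocks (`tadj_tcoarse`), chains to chains (`tLinked_image_tcoarse`) and torus localization domains to
localization domains of the coarse torus (`tFaceConnected_image_tcoarse`); rescaling an admissible graph by 1/L gives an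
admissible graph for the family of blocks met (`tAdmissible_scale`) and **[Dimock2013] Lemma 10's exact coarsening
for `torusTreeLen`**: L · d_{k+1}(X̄′) ≤ d_k(X̄) (`mul_torusTreeLen_image_le`).  Part 3 — X̃ ON THE TORUS: □̃ and X̃ as
families of cubes of the torus (`tblock`, `tcollar` = projections of pv11's `block`/`collar` of the standard lift),
|□̃| ≤ 3^d, X̄ ⊆ X̃, |X̃| ≤ 3^d|X̄|, |X̃ ∖ X̄| ≤ (3^d − 1)|X̄| (`card_tblock_le`, `subset_tcollar`, `card_tcollar_le`,
`card_tcollar_sdiff_le`), chain lemmas for `TLinked` (`tLinked_mono/symm/trans`, `tLinked_tblock_center`) and X̃ a torus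
localization domain when X̄ is (`tFaceConnected_tcollar`).  Part 4 — **THE SCALE TRANSFER ON THE TORUS**: Z ↦ Z′ =
the blocks met by Z̃ (`tclosure L N′ Z = (tcollar Z).image (tcoarse L N′)`; non-empty, a localization domain of the
coarse torus: `tclosure_nonempty`, `tFaceConnected_tclosure`), and for every localization domain Z̄ of the torus with
L·N′ cubes per direction
  L · torusTreeLen (Z′) ≤ (1 + 4·2^d(3^d − 1)) · torusTreeLen Z̄ + 2^d(3^d − 1)   (`scaleTransfer_torus_sharp`),
d = 4: ≤ 5121 · d_k(Z̄) + 1280 (`scaleTransfer_torus_four`), also with pv11's published-leaf constants (A_d, B_d)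
(`scaleTransfer_torus`), the exponential form used on pp. 19–20 (`exp_transfer_torus_four`), and the closure map between
the torus catalogues `tclosureDom L N′ : TDom d (L·N′) → TDom d N′` with the transfer stated for the `dj` of
`tsys d (L·N′)`, `tsys d N′` (`scaleTransfer_tsys`) — the torus twins of `TreeLength.scaleTransfer_treeLen_sharp` /
`_four` / `scaleTransfer_treeLen`, i.e. the kernel SUBSTITUTE for (2.36) (cell GAPS.md G-B13-09) on the papers'
PERIODIC carrier.

WHAT IS *NOT* CLAIMED.  (i) The printed (2.36) (factor exactly ½L, no additive constant) — unproved in print, false for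
L ≤ 5 (G-B13-09 (i)); nor the cell's SHARP certified factor a(L) = 3 + 4/(L − 2) of `…B13Geometry236` (unit pv11 gen 2,
window model): its torus version (the whisker / separated-net construction through the covering map) is NOT in this
module, so the multiplicative transfer `B13.Ineq236With (tsys d (L·N′)) (tsys d N′) (tclosureDom L N′) ℓ` with ℓ > 1 is
not delivered here — only the affine substitute with the direct-chain constants, whose d = 4 factor L/5121 is < 1 for
every admitted L ≤ 5121 (same caveat as `B13ScaleTransfer.R22subst_four_forces` for the window chain).  (ii) L ∣ N is
built in (fine torus with L·N′ cubes per direction); this is the papers' situation ([Balaban1987RG1] p. 251: the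
lattices T^{(j)} have 2L^{m+K−j}… sites per direction, cubes of side M = L^m), not an extra hypothesis on them.
(iii) As in `…TreeLengthTorus` / `…TreeLengthTorusGeometry`, the identification of `torusTreeLen` with the printed d_j
rests on READING D-pv22g2.1 and conventions D-pv22.1; for N′ = 1, 2 the torus adjacency degenerates and all statements
remain true as stated.  (iv) Nothing about Lemma 3, the R-operation or the series.  Value = kernel-checked carrier
migration of published, proved bookkeeping lemmas and of the cell's (2.36) substitute to the periodic carrier (closes
the coarsening / adjoining / affine-transfer part of DIVERGENCE D-pv22.3), NOT summit progress.
-/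

namespace Literature.MathematicalPhysics.QuantumFieldTheory.Balaban1983to89.TreeLengthTorusTransfer

noncomputable section

open Literature.MathematicalPhysics.QuantumFieldTheory.Balaban1983to89
open Literature.MathematicalPhysics.QuantumFieldTheory.Balaban1983to89.B13ScaleTransfer
open Literature.MathematicalPhysics.QuantumFieldTheory.Balaban1983to89.TreeLength
open Literature.MathematicalPhysics.QuantumFieldTheory.Balaban1983to89.TreeLengthTorus
open Literature.MathematicalPhysics.QuantumFieldTheory.Balaban1983to89.TreeLengthTorusGeometry

variable {d : ℕ} {N : ℕ}

/-! ## Part 1. Adjoining cubes on the torus: [Dimock2013] Lemma 20 for `torusTreeLen` -/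

/-- ADJOIN STEP ON THE TORUS ([Dimock2013] §4 Lemma 20, proof, one cube; window version `TreeLength.adjoin_step`):
an admissible graph (universal-cover sense) for the torus family Ā extends to one for Ā ∪ {c̄}, c̄ a cube of the torus
having a common wall — wrap-around walls included — with a cube ā of Ā, at cost ≤ 1: lift the wall through the met
lift of ā (`exists_lift_adj`) and run one segment inside that lift to the common wall
(`TreeLength.exists_wall_point`). [cite: Dimock2013, §4 Lemma 20 (proof)] -/
theorem tadjoin_step {A : Finset (TPt d N)} {T : List (Seg d)} (hT : TAdmissible A T) {a c : TPt d N}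
    (ha : a ∈ A) (hac : TAdj a c) : ∃ T', TAdmissible (insert c A) T' ∧ len T' ≤ len T + 1 := by
  obtain ⟨x, hxa, p, hpT, hpx⟩ := hT.meets a ha
  subst hxa
  obtain ⟨y, hyc, hxy⟩ := exists_lift_adj hac
  obtain ⟨q, hqx, hqy, hpq⟩ := exists_wall_point hxy hpx
  refine ⟨(p, q) :: T, ⟨?_, ?_, ?_⟩, ?_⟩
  · rw [carrier_cons]
    exact IsConnected.union ⟨p, left_mem_segment ℝ p q, hpT⟩
      ((convex_segment p q).isConnected ⟨p, left_mem_segment ℝ p q⟩) hT.connected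
  · rw [carrier_cons, Set.union_subset_iff]
    exact ⟨((convex_cube x).segment_subset hpx hqx).trans
        (cube_subset_liftCubes (Finset.mem_insert_of_mem ha)),
      hT.subset.trans (liftCubes_mono (Finset.subset_insert c A))⟩
  · intro b hb
    rcases Finset.mem_insert.1 hb with rfl | hb
    · exact ⟨y, hyc, q, Set.mem_union_left _ (right_mem_segment ℝ p q), hqy⟩
    · obtain ⟨z, hzb, r, hr, hrz⟩ := hT.meets b hb
      exact ⟨z, hzb, r, Set.mem_union_right _ hr, hrz⟩
  · rw [len_cons]
    change dist p q + len T ≤ len T + 1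
    linarith

/-- GREEDY EXTENSION ON THE TORUS ([Dimock2013] Lemma 20 mechanism; window version `TreeLength.exists_admissible_extend`):
an admissible graph for X̄ ⊆ Ȳ, Ȳ a torus localization domain, extends to one for Ȳ at cost ≤ |Ȳ ∖ X̄| — one torus
frontier cube at a time (`exists_tfrontier`, `tadjoin_step`). [cite: Dimock2013, §4 Lemma 20] -/
theorem exists_tAdmissible_extend {Y : Finset (TPt d N)} (hY : TFaceConnected Y) :
    ∀ n : ℕ, ∀ (X : Finset (TPt d N)) (T : List (Seg d)), X ⊆ Y → (Y \ X).card = n → TAdmissible X T →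
      ∃ T', TAdmissible Y T' ∧ len T' ≤ len T + n := by
  intro n
  induction n with
  | zero =>
    intro X T hXY hcard hT
    have hXeq : X = Y :=
      Finset.Subset.antisymm hXY (Finset.sdiff_eq_empty_iff_subset.1 (Finset.card_eq_zero.1 hcard))
    rw [hXeq] at hT
    exact ⟨T, hT, by simp⟩
  | succ n ih =>
    intro X T hXY hcard hT
    obtain ⟨x₀, hx₀⟩ := finset_nonempty_of_tAdmissible hT
    have hne : (Y \ X).Nonempty := by
      rw [← Finset.card_pos, hcard]
      exact Nat.succ_pos n
    obtain ⟨y, hy⟩ := hne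
    rw [Finset.mem_sdiff] at hy
    obtain ⟨a, ha, c, hc, hcX, hac⟩ := exists_tfrontier hXY hY hx₀ hy.1 hy.2
    obtain ⟨T₁, hT₁, hlen₁⟩ := tadjoin_step hT ha hac
    have hsub : insert c X ⊆ Y := Finset.insert_subset hc hXY
    have hcard' : (Y \ insert c X).card = n := by
      rw [Finset.sdiff_insert, Finset.card_erase_of_mem (Finset.mem_sdiff.2 ⟨hc, hcX⟩), hcard]
      simp
    obtain ⟨T', hT', hlen'⟩ := ih (insert c X) T₁ hsub hcard' hT₁
    refine ⟨T', hT', ?_⟩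
    push_cast
    linarith

/-- An admissible graph for X̄ extends to one for any torus localization domain Ȳ ⊇ X̄ at cost ≤ |Ȳ ∖ X̄|
(window version `TreeLength.exists_admissible_of_subset`). [cite: Dimock2013, §4 Lemma 20] -/
theorem exists_tAdmissible_of_subset {X Y : Finset (TPt d N)} (hXY : X ⊆ Y) (hY : TFaceConnected Y)
    {T : List (Seg d)} (hT : TAdmissible X T) :
    ∃ T', TAdmissible Y T' ∧ len T' ≤ len T + ((Y \ X).card : ℕ) :=
  exists_tAdmissible_extend hY _ X T hXY rfl hT

section Periodic

variable [NeZero N]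

/-- THE ADJOINING INEQUALITY ON THE TORUS — [Dimock2013] §4 Lemma 20, verbatim: *"For X, Y ∈ 𝒟_k and X ⊂ Y:
M d_M(Y) ≤ M|Y − X|_M + M d_M(X)"* — PROVED for `torusTreeLen`: d(Ȳ) ≤ |Ȳ ∖ X̄| + d(X̄) for torus localization
domains X̄ ⊆ Ȳ ([Dimock2013]'s carrier IS a torus, §3: *"Here the tree is in the continuum torus"*; window version
`TreeLength.treeLen_le_card_sdiff_add` = pv11's `AdjoinLeaf`). [cite: Dimock2013, §4 Lemma 20] -/
theorem torusTreeLen_le_card_sdiff_add {X Y : Finset (TPt d N)} (hX : X.Nonempty) (hXY : X ⊆ Y)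
    (hXc : TFaceConnected X) (hYc : TFaceConnected Y) :
    torusTreeLen Y ≤ ((Y \ X).card : ℝ) + torusTreeLen X := by
  refine le_of_forall_pos_le_add fun ε hε => ?_
  have hne : ∃ T, TAdmissible X T := (exists_tAdmissible hX hXc).imp fun T h => h.1
  obtain ⟨T, hT, hlt⟩ := exists_tAdmissible_len_lt hne hε
  obtain ⟨T', hT', hlen'⟩ := exists_tAdmissible_of_subset hXY hYc hT
  linarith [torusTreeLen_le_len hT']

end Periodic

/-! ## Part 2. Two nested tori (L ∣ N: N = L·N′), the block map π_k → π_{k+1} on the torus, exact coarsening -/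

/-- Integer division by L commutes with the periods: ⌊(x + L·N′·k)/L⌋ = ⌊x/L⌋ + N′·k coordinatewise — the block map
`coarse L` of the universal cover intertwines the deck groups L·N′·ℤ^d (fine torus) and N′·ℤ^d (coarse torus). [folklore] -/
theorem coarse_add_period {L : ℕ} (hL : 0 < L) (N' : ℕ) (x k : Pt d) :
    coarse L (x + period (L * N') k) = coarse L x + period N' k := by
  have hL' : (L : ℤ) ≠ 0 := by exact_mod_cast hL.ne'
  funext i
  simp only [coarse, period, Pi.add_apply, Nat.cast_mul]
  have e : x i + (L : ℤ) * (N' : ℤ) * k i = x i + (N' : ℤ) * k i * (L : ℤ) := by ring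
  rw [e, Int.add_mul_ediv_right _ _ hL']

section TwoTori

variable (L N' : ℕ) [NeZero L] [NeZero N']

/-- THE BLOCK MAP ON THE TORUS.  [Balaban1988RG2Cluster] p. 13, verbatim (as quoted in `…B13ScaleTransfer.coarse`):
*"we take cubes from π_{k+1}, i.e. cubes of the size LM in the scale corresponding to the lattice T_η"* — on the
PERIODIC carrier of [Balaban1987RG1] p. 251 the π_{k+1}-cubes are the blocks of L^d cubes of π_k of the SAME torus,
so with N = L·N′ cubes of π_k per direction there are N′ cubes of π_{k+1} per direction, and the cube of index
ā ∈ (ℤ/N)^d lies in the block of index ⌊a/L⌋ mod N′ (well defined: `tcoarse_proj`).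
[cite: Balaban1988RG2Cluster, p.13 (cubes of the size LM)] -/
def tcoarse (a : TPt d (L * N')) : TPt d N' := proj N' (coarse L (natLift a))

variable {L N'}

/-- The block map is induced by `coarse L` on the universal cover: for EVERY lift x of a torus cube,
tcoarse (proj x) = proj (coarse L x). [folklore] -/
theorem tcoarse_proj (x : Pt d) : tcoarse L N' (proj (L * N') x) = proj N' (coarse L x) := by
  have hL : 0 < L := Nat.pos_of_ne_zero (NeZero.ne L)
  obtain ⟨k, hk⟩ := exists_period_of_proj_eq (proj_natLift (proj (L * N') x)).symm
  unfold tcoarse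
  rw [hk, coarse_add_period hL N', proj_add_period]

/-- Torus wall-neighbours lie in the same block or in blocks with a common wall of the coarse torus
(window version `B13ScaleTransfer.coarse_adj`). [folklore] -/
theorem tadj_tcoarse {a b : TPt d (L * N')} (h : TAdj a b) :
    tcoarse L N' a = tcoarse L N' b ∨ TAdj (tcoarse L N' a) (tcoarse L N' b) := by
  have hL : 0 < L := Nat.pos_of_ne_zero (NeZero.ne L)
  obtain ⟨x, rfl⟩ : ∃ x : Pt d, proj (L * N') x = a := ⟨natLift a, proj_natLift a⟩
  obtain ⟨y, rfl, hxy⟩ := exists_lift_adj h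
  rw [tcoarse_proj, tcoarse_proj]
  rcases coarse_adj hL hxy with h' | h'
  · exact Or.inl (by rw [h'])
  · exact Or.inr (proj_adj h')

/-- Chains of the fine torus map to chains of the coarse torus. [folklore] -/
theorem tLinked_image_tcoarse {S : Finset (TPt d (L * N'))} {a b : TPt d (L * N')} (h : TLinked S a b) :
    TLinked (S.image (tcoarse L N')) (tcoarse L N' a) (tcoarse L N' b) := by
  unfold TLinked at h ⊢
  induction h with
  | refl => exact Relation.ReflTransGen.refl
  | tail _ hbc ih =>
    rcases tadj_tcoarse hbc.2.2 with h' | h'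
    · rw [← h']
      exact ih
    · exact ih.tail ⟨Finset.mem_image_of_mem _ hbc.1, Finset.mem_image_of_mem _ hbc.2.1, h'⟩

/-- The family of blocks met by a torus localization domain is a localization domain of the coarse torus
([Balaban1988RG2Cluster] p. 13: *"Z′₀ is a union of the smallest family of such cubes containing Z̃₀"*, p. 19: *"the
smallest localization domain from 𝐃_{k+1} containing Z̃_i"*; window version
`B13ScaleTransfer.faceConnected_closureIdx`). [cite: Balaban1988RG2Cluster, p.13/p.19 (definition of Z′)] -/
theorem tFaceConnected_image_tcoarse {S : Finset (TPt d (L * N'))} (hS : TFaceConnected S) :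
    TFaceConnected (S.image (tcoarse L N')) := by
  intro a ha b hb
  obtain ⟨x, hx, rfl⟩ := Finset.mem_image.1 ha
  obtain ⟨y, hy, rfl⟩ := Finset.mem_image.1 hb
  exact tLinked_image_tcoarse (hS x hx y hy)

/-- RESCALING ON THE TORUS ([Dimock2013] §3, proof of Lemma 10, verbatim: *"If X̄ = Y then a minimal tree on the M
blocks in X is also a tree on the LM blocks in Y"*; window version `TreeLength.admissible_scale`): the image under
p ↦ p/L of a graph admissible for X̄ (in the universal cover of the fine torus) is admissible for the family of blocks
met by X̄ (in the universal cover of the coarse torus — the same ℝ^d, rescaled). [cite: Dimock2013, §3 Lemma 10 (reblocking), proof l.1] -/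
theorem tAdmissible_scale {X : Finset (TPt d (L * N'))} {T : List (Seg d)} (hT : TAdmissible X T) :
    TAdmissible (X.image (tcoarse L N')) (T.map (scaleSeg (L : ℝ)⁻¹)) := by
  have hL : 0 < L := Nat.pos_of_ne_zero (NeZero.ne L)
  have hcont : Continuous fun z : RPt d => (L : ℝ)⁻¹ • z := continuous_const_smul _
  refine ⟨?_, ?_, ?_⟩
  · rw [carrier_map_scaleSeg]
    exact hT.connected.image _ hcont.continuousOn
  · rw [carrier_map_scaleSeg]
    rintro _ ⟨p, hp, rfl⟩
    obtain ⟨x, hx, hpx⟩ := mem_liftCubes.1 (hT.subset hp)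
    refine mem_liftCubes.2 ⟨coarse L x, ?_, smul_mem_cube_coarse hL hpx⟩
    rw [← tcoarse_proj]
    exact Finset.mem_image_of_mem _ hx
  · intro b hb
    rw [Finset.mem_image] at hb
    obtain ⟨a, ha, rfl⟩ := hb
    obtain ⟨x, hxa, p, hpT, hpx⟩ := hT.meets a ha
    refine ⟨coarse L x, ?_, (L : ℝ)⁻¹ • p, ?_, smul_mem_cube_coarse hL hpx⟩
    · rw [← tcoarse_proj, hxa]
    · rw [carrier_map_scaleSeg]
      exact Set.mem_image_of_mem _ hpT

/-- EXACT COARSENING ON THE TORUS — [Dimock2013] §3, proof of Lemma 10, verbatim: *"… and so M d_M(X) ≥ LM d_{LM}(Y)"*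
— PROVED for `torusTreeLen` under L ∣ N: L · d_{k+1}(X̄′) ≤ d_k(X̄) for every torus localization domain X̄ of the
torus with L·N′ cubes per direction, X̄′ = the blocks met by X̄ (window version `TreeLength.mul_treeLen_closureIdx_le`
= pv11's `CoarseningLeaf`). [cite: Dimock2013, §3 Lemma 10 (reblocking), proof l.1] -/
theorem mul_torusTreeLen_image_le {X : Finset (TPt d (L * N'))} (hX : X.Nonempty) (hc : TFaceConnected X) :
    (L : ℝ) * torusTreeLen (X.image (tcoarse L N')) ≤ torusTreeLen X := by
  have hL : 0 < L := Nat.pos_of_ne_zero (NeZero.ne L)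
  have hLr : (0 : ℝ) < L := by exact_mod_cast hL
  have hne : ∃ T, TAdmissible X T := (exists_tAdmissible hX hc).imp fun T h => h.1
  refine le_torusTreeLen hne fun T hT => ?_
  have h1 := torusTreeLen_le_len (tAdmissible_scale hT)
  rw [len_map_scaleSeg (inv_nonneg.2 hLr.le)] at h1
  calc (L : ℝ) * torusTreeLen (X.image (tcoarse L N')) ≤ (L : ℝ) * ((L : ℝ)⁻¹ * len T) :=
        mul_le_mul_of_nonneg_left h1 hLr.le
    _ = len T := by field_simp

end TwoTori

/-! ## Part 3. X̃ on the torus: one layer of cubes adjoined -/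

/-- □̃ ON THE TORUS: the (at most 3^d) cubes of the torus within sup-distance 1 of the cube ā, wrap-around included —
[Balaban1987RG1] p. 257, verbatim (as quoted in `…B13ScaleTransfer.block`): *"we define □̃ⁿ as a cube of the size
(1 + 2n)M and with a center at the center of □"*, n = 1, as a family of cubes of the TORUS (the projection of the
window block `B13ScaleTransfer.block` of the standard lift). [cite: Balaban1987RG1, p.257 (definition of □̃ⁿ)] -/
def tblock (a : TPt d N) : Finset (TPt d N) := (B13ScaleTransfer.block (natLift a)).image (proj N)

/-- X̃ ON THE TORUS: the domain X̄ with one layer of cubes of the torus adjoined ([Balaban1987RG1] p. 257: *"The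
meaning of the symbol X̃ⁿ should be obvious"*), the union of the □̃ over the cubes □ of X̄ (window version
`B13ScaleTransfer.collar`). [cite: Balaban1987RG1, p.257 (definition of X̃ⁿ)] -/
def tcollar (S : Finset (TPt d N)) : Finset (TPt d N) := S.biUnion tblock

/-- □̃ has at most 3^d cubes on the torus. [folklore] -/
theorem card_tblock_le (a : TPt d N) : (tblock a).card ≤ 3 ^ d :=
  Finset.card_image_le.trans (card_block _).le

/-- |X̃| ≤ 3^d |X̄| on the torus. [folklore] -/
theorem card_tcollar_le (S : Finset (TPt d N)) : (tcollar S).card ≤ 3 ^ d * S.card := by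
  calc (tcollar S).card ≤ ∑ a ∈ S, (tblock a).card := Finset.card_biUnion_le
    _ ≤ ∑ a ∈ S, 3 ^ d := Finset.sum_le_sum fun a _ => card_tblock_le a
    _ = 3 ^ d * S.card := by rw [Finset.sum_const, smul_eq_mul, mul_comm]

/-- A chain inside S̄ is a chain inside every larger family. [folklore] -/
theorem tLinked_mono {S S' : Finset (TPt d N)} (hSS' : S ⊆ S') {x y : TPt d N} (h : TLinked S x y) :
    TLinked S' x y := by
  unfold TLinked at *
  induction h with
  | refl => exact Relation.ReflTransGen.refl
  | tail _ hbc ih => exact Relation.ReflTransGen.tail ih ⟨hSS' hbc.1, hSS' hbc.2.1, hbc.2.2⟩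

/-- Chains of the torus can be reversed. [folklore] -/
theorem tLinked_symm {S : Finset (TPt d N)} {x y : TPt d N} (h : TLinked S x y) : TLinked S y x := by
  unfold TLinked at *
  induction h with
  | refl => exact Relation.ReflTransGen.refl
  | tail _ hbc ih => exact Relation.ReflTransGen.head ⟨hbc.2.1, hbc.1, hbc.2.2.symm⟩ ih

/-- Chains of the torus concatenate. [folklore] -/
theorem tLinked_trans {S : Finset (TPt d N)} {x y z : TPt d N} (h₁ : TLinked S x y) (h₂ : TLinked S y z) :
    TLinked S x z :=
  Relation.ReflTransGen.trans h₁ h₂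

/-- □̃ ⊆ X̃ for every cube □ of X̄ (torus). [folklore] -/
theorem tblock_subset_tcollar {S : Finset (TPt d N)} {a : TPt d N} (ha : a ∈ S) : tblock a ⊆ tcollar S :=
  Finset.subset_biUnion_of_mem tblock ha

section Periodic

variable [NeZero N]

/-- □ is one of the cubes of □̃ (torus). [folklore] -/
theorem mem_tblock_self (a : TPt d N) : a ∈ tblock a :=
  Finset.mem_image.2 ⟨natLift a, mem_block_self _, proj_natLift a⟩

/-- X̄ ⊆ X̃ on the torus. [folklore] -/
theorem subset_tcollar (S : Finset (TPt d N)) : S ⊆ tcollar S :=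
  fun a ha => Finset.mem_biUnion.2 ⟨a, ha, mem_tblock_self a⟩

/-- The counting step on the torus: |X̃ ∖ X̄| ≤ (3^d − 1)|X̄| (window version `B13ScaleTransfer.card_collar_sdiff_le`). [folklore] -/
theorem card_tcollar_sdiff_le (S : Finset (TPt d N)) : ((tcollar S \ S).card : ℝ) ≤ (3 ^ d - 1) * S.card := by
  have h : (tcollar S \ S).card + S.card ≤ 3 ^ d * S.card := by
    rw [Finset.card_sdiff_add_card_eq_card (subset_tcollar S)]
    exact card_tcollar_le S
  have h' : ((tcollar S \ S).card : ℝ) + (S.card : ℝ) ≤ (3 : ℝ) ^ d * S.card := by exact_mod_cast h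
  linarith

/-- Every cube of □̃ is chain-connected to □ inside □̃, on the torus (projection of `B13ScaleTransfer.linked_block_center`). [folklore] -/
theorem tLinked_tblock_center {a b : TPt d N} (hb : b ∈ tblock a) : TLinked (tblock a) a b := by
  obtain ⟨y, hy, rfl⟩ := Finset.mem_image.1 hb
  have h := tLinked_image (N := N) (linked_block_center hy)
  rwa [proj_natLift] at h

/-- X̃ is a torus localization domain whenever X̄ is (used silently on p. 19 of [Balaban1988RG2Cluster]: Z′_i is
*"the smallest localization domain from 𝐃_{k+1} containing Z̃_i"*; window version `B13ScaleTransfer.faceConnected_collar`). [folklore] -/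
theorem tFaceConnected_tcollar {S : Finset (TPt d N)} (hS : TFaceConnected S) : TFaceConnected (tcollar S) := by
  intro x hx y hy
  obtain ⟨c, hc, hxc⟩ : ∃ c ∈ S, x ∈ tblock c := by simpa [tcollar] using hx
  obtain ⟨c', hc', hyc'⟩ : ∃ c' ∈ S, y ∈ tblock c' := by simpa [tcollar] using hy
  have h1 : TLinked (tcollar S) x c :=
    tLinked_symm (tLinked_mono (tblock_subset_tcollar hc) (tLinked_tblock_center hxc))
  have h2 : TLinked (tcollar S) c c' := tLinked_mono (subset_tcollar S) (hS c hc c' hc')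
  have h3 : TLinked (tcollar S) c' y := tLinked_mono (tblock_subset_tcollar hc') (tLinked_tblock_center hyc')
  exact tLinked_trans (tLinked_trans h1 h2) h3

end Periodic

/-! ## Part 4. The scale transfer behind (2.36) on the torus: Z ↦ Z′ and L·d_{k+1}(Z′) ≤ A·d_k(Z) + B -/

section TwoTori

variable (L N' : ℕ) [NeZero L] [NeZero N']

/-- Z ↦ Z′ ON THE TORUS — [Balaban1988RG2Cluster] p. 19, verbatim (as quoted in `…B13ScaleTransfer.closureIdx`): *"we
denote by Z′_i the smallest localization domain from 𝐃_{k+1} containing Z̃_i"* (p. 13: *"Z′₀ is a union of the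
smallest family of such cubes containing Z̃₀"*): the blocks of the coarse torus (N′ per direction) met by Z̃, for Z̄ a
family of cubes of the fine torus (L·N′ per direction); window version `closureIdx L (collar Z)`.
[cite: Balaban1988RG2Cluster, p.13/p.19 (definition of Z′)] -/
def tclosure (Z : Finset (TPt d (L * N'))) : Finset (TPt d N') := (tcollar Z).image (tcoarse L N')

variable {L N'}

/-- Z′ is non-empty when Z̄ is. [folklore] -/
theorem tclosure_nonempty {Z : Finset (TPt d (L * N'))} (hZ : Z.Nonempty) : (tclosure L N' Z).Nonempty :=
  (hZ.mono (subset_tcollar Z)).image _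

/-- Z′ is a localization domain of the coarse torus whenever Z̄ is one of the fine torus (p. 19: *"the smallest
localization domain from 𝐃_{k+1} containing Z̃_i"* — PROVED on the periodic index model; window version
`B13ScaleTransfer.faceConnected_closure`). [folklore] -/
theorem tFaceConnected_tclosure {Z : Finset (TPt d (L * N'))} (hc : TFaceConnected Z) :
    TFaceConnected (tclosure L N' Z) :=
  tFaceConnected_image_tcoarse (tFaceConnected_tcollar hc)

/-- THE SCALE TRANSFER ON THE TORUS with the constants of the direct chain (coarsening → adjoining the collar →
|Z̃ ∖ Z| ≤ (3^d − 1)|Z| → |Z| ≤ 2^d(4d(Z) + 1)): for every localization domain Z̄ of the torus with L·N′ cubes per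
direction, L · d_{k+1}(Z′) ≤ (1 + 4·2^d(3^d − 1)) d_k(Z̄) + 2^d(3^d − 1) — the torus twin of
`TreeLength.scaleTransfer_treeLen_sharp`, i.e. the kernel SUBSTITUTE for [Balaban1988RG2Cluster] (2.36) p. 19
(verbatim: *"2d_k(Z_i) ≧ Ld_{k+1}(Z′_i). (2.36) This inequality can be obtained by simple, but awkward, geometric and
combinatoric considerations."*; cell GAPS.md G-B13-09: unproved in print, false for L ≤ 5) on the papers' PERIODIC
carrier, under L ∣ N. [cite: Balaban1988RG2Cluster, (2.36) p.19] -/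
theorem scaleTransfer_torus_sharp {Z : Finset (TPt d (L * N'))} (hZ : Z.Nonempty) (hc : TFaceConnected Z) :
    (L : ℝ) * torusTreeLen (tclosure L N' Z) ≤
      (1 + 4 * 2 ^ d * (3 ^ d - 1)) * torusTreeLen Z + 2 ^ d * (3 ^ d - 1) := by
  have hZc : (tcollar Z).Nonempty := hZ.mono (subset_tcollar Z)
  have hcc : TFaceConnected (tcollar Z) := tFaceConnected_tcollar hc
  have h1 : (L : ℝ) * torusTreeLen (tclosure L N' Z) ≤ torusTreeLen (tcollar Z) :=
    mul_torusTreeLen_image_le hZc hcc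
  have h2 : torusTreeLen (tcollar Z) ≤ ((tcollar Z \ Z).card : ℝ) + torusTreeLen Z :=
    torusTreeLen_le_card_sdiff_add hZ (subset_tcollar Z) hc hcc
  have h3 : ((tcollar Z \ Z).card : ℝ) ≤ (3 ^ d - 1) * Z.card := card_tcollar_sdiff_le Z
  have h4 : (Z.card : ℝ) ≤ 2 ^ d * (4 * torusTreeLen Z + 1) := card_le_torusTreeLen hZ hc
  have h3d : (0 : ℝ) ≤ 3 ^ d - 1 := by
    have : (1 : ℝ) ≤ 3 ^ d := one_le_pow₀ (by norm_num)
    linarith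
  have h5 : (3 ^ d - 1 : ℝ) * Z.card ≤ (3 ^ d - 1) * (2 ^ d * (4 * torusTreeLen Z + 1)) :=
    mul_le_mul_of_nonneg_left h4 h3d
  have expand : torusTreeLen Z + (3 ^ d - 1 : ℝ) * (2 ^ d * (4 * torusTreeLen Z + 1))
      = (1 + 4 * 2 ^ d * (3 ^ d - 1)) * torusTreeLen Z + 2 ^ d * (3 ^ d - 1) := by ring
  linarith

/-- … and with pv11's published-leaf constants (A_d, B_d) = (1 + 8(3^d − 1)(2^d + 1), 4(3^d − 1)(2^d + 1)) of
`B13ScaleTransfer.scaleTransfer_of_leaves` (weaker; recorded for comparability with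
`TreeLength.scaleTransfer_treeLen`). [cite: Balaban1988RG2Cluster, (2.36) p.19] -/
theorem scaleTransfer_torus {Z : Finset (TPt d (L * N'))} (hZ : Z.Nonempty) (hc : TFaceConnected Z) :
    (L : ℝ) * torusTreeLen (tclosure L N' Z) ≤ Acoef d * torusTreeLen Z + Bcoef d := by
  have h := scaleTransfer_torus_sharp hZ hc
  have ht : 0 ≤ torusTreeLen Z := torusTreeLen_nonneg Z
  have h3d : (0 : ℝ) ≤ 3 ^ d - 1 := by
    have : (1 : ℝ) ≤ 3 ^ d := one_le_pow₀ (by norm_num)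
    linarith
  have h2d : (0 : ℝ) ≤ 2 ^ d := by positivity
  have hA : (1 + 4 * 2 ^ d * (3 ^ d - 1) : ℝ) ≤ Acoef d := by
    unfold Acoef
    nlinarith [mul_nonneg h2d h3d]
  have hB : (2 ^ d * (3 ^ d - 1) : ℝ) ≤ Bcoef d := by
    unfold Bcoef
    nlinarith [mul_nonneg h2d h3d]
  nlinarith [mul_le_mul_of_nonneg_right hA ht]

/-- d = 4: L · d_{k+1}(Z′) ≤ 5121 d_k(Z̄) + 1280 for every localization domain Z̄ of the four-dimensional torus with
L·N′ cubes per direction (torus twin of `TreeLength.scaleTransfer_treeLen_four`). [cite: Balaban1988RG2Cluster, (2.36) p.19] -/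
theorem scaleTransfer_torus_four {Z : Finset (TPt 4 (L * N'))} (hZ : Z.Nonempty) (hc : TFaceConnected Z) :
    (L : ℝ) * torusTreeLen (tclosure L N' Z) ≤ 5121 * torusTreeLen Z + 1280 := by
  have h := scaleTransfer_torus_sharp (d := 4) hZ hc
  norm_num at h
  exact h

/-- How the transfer is USED (pp. 19–20: *"The remaining exponential is bounded using the following inequality"* (2.36),
then p. 20 ll. 2–3: *"(1 − 5δ)κd_k(Z_i) in the exponentials replaced by (1 − 6δ)½Lκd_{k+1}(Z′_i)"*), in the
substitute's affine form on the torus, d = 4: for every rate a ≥ 0, exp(−a d_k(Z̄)) ≤ e^{1280a/5121} ·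
exp(−(aL/5121) d_{k+1}(Z′)) (pv11's `exp_transfer`). [cite: Balaban1988RG2Cluster, p.19–20 ((2.36) ⇒ (2.37))] -/
theorem exp_transfer_torus_four {Z : Finset (TPt 4 (L * N'))} (hZ : Z.Nonempty) (hc : TFaceConnected Z)
    {a : ℝ} (ha : 0 ≤ a) :
    Real.exp (-(a * torusTreeLen Z)) ≤
      Real.exp (a * 1280 / 5121) * Real.exp (-(a * L / 5121 * torusTreeLen (tclosure L N' Z))) :=
  exp_transfer (by norm_num) ha (scaleTransfer_torus_four hZ hc)

/-- THE CLOSURE MAP Z ↦ Z′ between the torus catalogues: from 𝐃_k of the torus with L·N′ cubes of π_k per direction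
(`tsys d (L·N′)`) to 𝐃_{k+1} of the same torus, N′ cubes of π_{k+1} per direction (`tsys d N′`); Z′ is a
localization domain by `tclosure_nonempty`, `tFaceConnected_tclosure`. [cite: Balaban1988RG2Cluster, p.19 (definition of Z′)] -/
def tclosureDom (L N' : ℕ) [NeZero L] [NeZero N'] (Z : TDom d (L * N')) : TDom d N' :=
  ⟨tclosure L N' Z.1, ⟨tclosure_nonempty Z.2.1, tFaceConnected_tclosure Z.2.2⟩⟩

/-- The closure map sends Z̄ to the index set Z′ of `scaleTransfer_torus_sharp`. [folklore] -/
@[simp] theorem tclosureDom_val (Z : TDom d (L * N')) : (tclosureDom L N' Z).1 = tclosure L N' Z.1 := rfl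

/-- The transfer between the two torus systems in `LocDomainSys` terms: for every Z ∈ 𝐃_k of the fine torus,
L · d_{k+1}(Z′) ≤ (1 + 4·2^d(3^d − 1)) · d_k(Z) + 2^d(3^d − 1) with d_k, d_{k+1} the `dj` of `tsys d (L·N′)`,
`tsys d N′`. [cite: Balaban1988RG2Cluster, (2.36) p.19] -/
theorem scaleTransfer_tsys (Z : (tsys d (L * N')).Dom) :
    (L : ℝ) * (tsys d N').dj (tclosureDom L N' Z) ≤
      (1 + 4 * 2 ^ d * (3 ^ d - 1)) * (tsys d (L * N')).dj Z + 2 ^ d * (3 ^ d - 1) :=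
  scaleTransfer_torus_sharp Z.2.1 Z.2.2

end TwoTori

end

end Literature.MathematicalPhysics.QuantumFieldTheory.Balaban1983to89.TreeLengthTorusTransfer
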